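import Summits.BirchSwinnertonDyer.BirchSwinnertonDyer.Theorems.AlignedTransportAtTwoMainConjectureOfRankZeroBSDAtTwoTwistSaturationLValue
import HarnessLib

/-!
# Route `AlignedTransportAtTwo`, crux C2 `MainConjectureOfRankZeroBSDAtTwo` (stmt-BirchSwinnertonDyer-22298):
# THE ANALYTIC SHADOW OF SATURATION — on a twist-saturated seed the Néron-normalised `2`-adic `L`-function is `(T+2)^{rank W⁽²⁾(ℚ)}` up to a unit
# of `Λ`: `μ_an = 0`, `λ_an = rank W⁽²⁾(ℚ)`, and the ORDER OF VANISHING AT THE TWIST CHARACTER `T = −2` IS EXACTLY `rank W⁽²⁾(ℚ)` (modulo PRINT + CERT)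

HONEST FRAMING (cell `bsd-f1-sign2`, WIDTH-5 attached prover seat `bsd-line-att-p5` gen 46 on line `birth` of the lead `bsd-line-att-p2`;
`--supports` stmt-BirchSwinnertonDyer-22298, closes nothing; BSD is NOT proved by any of this; the crux C2, its verdict «blocked-on
`Rank1Residual.GreenbergMuConjectureIrreducible`» and every registered stub are untouched). THEOREMS ONLY — no `def`, no instance, no named fact, no `sorry`.

Sequel of `…TwistSaturation` (p811907) / `…TwistSaturationLValue` (p812157). There: saturation ⟹ `char_Λ X(W/ℚ_∞) = ((T+2)^{rank W₂(ℚ)})` and, modulo PRINT,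
`MazurMainConjecture W 2` (`char X = (ϖ·L₂(f,α))` for the Néron-normalised lift). Reading the two together: the integral lift `g` of `ϖ·L₂(f, α)` is
ASSOCIATED to `(T+2)^{rank W₂(ℚ)}` in `Λ = ℤ₂⟦T⟧`; hence `μ(g) = 0`, `λ(g) = rank W₂(ℚ)` and `HasOrderAtNegTwo g (rank W₂(ℚ))` — the `2`-adic `L`-function of `W`
vanishes at the order-`2` character `χ₈` (i.e. at `T = −2`, the point interpolating `L(W⁽²⁾, 1)`) to order EXACTLY the Mordell–Weil rank of the twist,
a `p`-adic-BSD-at-`χ₈` equality obtained from two rational points.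

* `associated_of_span_singleton_eq` / `lam_mu_of_associated_X_add_C_two_pow` / `hasOrderAtNegTwo_of_associated_X_add_C_two_pow` (algebra in `ℤ₂⟦T⟧`).
* ★★★ `padicLFunction_associated_of_bsdp_of_lValue_of_le_mordellWeilRank_twist` (cell currency; PRINT `h17`, `hper`, `hmod`, `hGZK`; CERT `r_an = 0`, `L`-value bit,
  `2·ord₂#Ẽ(𝔽₂) ≤ rank W₂(ℚ)`): for every normalised cyclotomic datum, every newform `f` of `W` at level `N_W` and every period ratio `ϖ`
  (`ϖ·Ω_W = Ω_f⁺`), there is `g ∈ Λ` with `ι g = ϖ·L₂(f, α)`, **`g ~ (T+2)^{rank W₂(ℚ)}`, `μ(g) = 0`, `λ(g) = rank W₂(ℚ)`, `ord_{T=−2} g = rank W₂(ℚ)`**.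

References: B. Mazur, J. Tate, J. Teitelbaum, Invent. Math. 84 (1986) §I.14 [MazurTateTeitelbaum1986Invent]; K. Kato, Astérisque 295 (2004), Thm. 17.4
[Kato2004Asterisque]; R. Greenberg, LNM 1716 (1999), Thm. 4.1, §4 p. 107 [GreenbergLNM1716].
-/

set_option linter.dupNamespace false
set_option autoImplicit false

noncomputable section

open scoped Classical MatrixGroups ModularForm

namespace Summit.BirchSwinnertonDyer.BirchSwinnertonDyer.Theorems.AlignedTransportAtTwoTwistSaturation

open PowerSeries CongruenceSubgroup WeierstrassCurve Literature.NumberTheory.EllipticCurves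
  Literature.NumberTheory.EllipticCurves.ModularForms
  Literature.NumberTheory.EllipticCurves.Rank1Residual
  Literature.NumberTheory.EllipticCurves.Greenberg1999
  Literature.NumberTheory.EllipticCurves.Module
  Literature.NumberTheory.EllipticCurves.IwasawaAlgebra
  Summit.BirchSwinnertonDyer.Rank1Residual
  Summit.BirchSwinnertonDyer.Rank1Residual.X1.MuLambda
  Summit.BirchSwinnertonDyer.Rank1Residual.X5
  Summit.BirchSwinnertonDyer.Rank1Residual.F1Sign2
  Summit.BirchSwinnertonDyer.Rank1Residual.Iwasawa
  Summit.BirchSwinnertonDyer.BirchSwinnertonDyer.Theorems.Rank1ResidualX1Defs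
  Summit.BirchSwinnertonDyer.BirchSwinnertonDyer.Theorems.AlignedTransportAtTwoEisensteinRigidityConservation
  Summit.BirchSwinnertonDyer.BirchSwinnertonDyer.Theorems.AlignedTransportAtTwoTwistReading

/-! ## §1 Algebra: associates of `(T+2)^r` -/

section Algebra

/-- Equal principal ideals have associated generators. [folklore] -/
theorem associated_of_span_singleton_eq {g h : IwasawaAlgebra 2} (heq : Ideal.span ({g} : Set (IwasawaAlgebra 2)) = Ideal.span {h}) :
    Associated g h :=
  Ideal.span_singleton_eq_span_singleton.mp heq

/-- **`g ~ (T+2)^r ⟹ μ(g) = 0 ∧ λ(g) = r`.** [cite: Washington1997, §7.1] -/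
theorem lam_mu_of_associated_X_add_C_two_pow {g : IwasawaAlgebra 2} {r : ℕ} (h : Associated ((X + C (2 : ℤ_[2])) ^ r) g) :
    mu g = 0 ∧ lam g = r := by
  obtain ⟨u, hu⟩ := h
  have hX : (X + C (2 : ℤ_[2]) : PowerSeries ℤ_[2]) ^ r ≠ 0 := pow_ne_zero _ prime_X_add_C_two.ne_zero
  have hune : ((u : PowerSeries ℤ_[2])) ≠ 0 := u.ne_zero
  obtain ⟨-, hmuu, hlamu⟩ := (isUnit_iff_mu_eq_zero_and_lam_eq_zero (u : PowerSeries ℤ_[2])).mp u.isUnit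
  constructor
  · rw [← hu, mu_mul hX hune, mu_X_add_C_two_pow, hmuu]
  · rw [← hu, lam_mul hX hune, lam_X_add_C_two_pow, hlamu, add_zero]

/-- **`g ~ (T+2)^r ⟹ ord_{T=−2} g = r`** (`(T+2)^r ∣ g`, and `(T+2)^{r+1} ∣ g` would make the prime `T+2` divide a unit). [folklore] -/
theorem hasOrderAtNegTwo_of_associated_X_add_C_two_pow {g : IwasawaAlgebra 2} {r : ℕ} (h : Associated ((X + C (2 : ℤ_[2])) ^ r) g) :
    HasOrderAtNegTwo g r := by
  obtain ⟨u, hu⟩ := h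
  refine ⟨⟨u, hu.symm⟩, ?_⟩
  rintro ⟨k, hk⟩
  have hX0 : (X + C (2 : ℤ_[2]) : PowerSeries ℤ_[2]) ^ r ≠ 0 := pow_ne_zero _ prime_X_add_C_two.ne_zero
  have hdvd : (X + C (2 : ℤ_[2]) : PowerSeries ℤ_[2]) ∣ (u : PowerSeries ℤ_[2]) := by
    refine ⟨k, mul_left_cancel₀ hX0 ?_⟩
    rw [hu, hk, pow_succ, mul_assoc]
  exact prime_X_add_C_two.not_unit (isUnit_of_dvd_unit hdvd u.isUnit)

end Algebra

/-! ## §2 The analytic shadow on a saturated seed -/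

section Cell

variable (W W₂ : WeierstrassCurve ℚ) [W.IsElliptic] [W.IsGloballyMinimal] [W₂.IsElliptic] {V : VariableChange ℚ}
  (hV : V • W₂ = W.quadraticTwist 2)

include hV in
/-- ★★★ **THE `2`-ADIC `L`-FUNCTION OF A TWIST-SATURATED SEED IS `(T+2)^{rank W⁽²⁾(ℚ)}` UP TO A UNIT.** `W` globally minimal, good ordinary at `2`, no rational
point of order `2`, `r_an(W) = 0`, `BSD(W,2)`, `∏c_ℓ` odd, `L(W,1)/Ω_W = q` (`q ≠ 0`, `ord₂ q = 0`); PRINT `h17`, `hper`, `hmod`, `hGZK`; `W₂` a `ℚ`-model of `W⁽²⁾`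
with `2·ord₂ #Ẽ(𝔽₂) ≤ rank W₂(ℚ)`. Then for every normalised cyclotomic datum `(κ, γ)`, every newform `f` of `W` at level `N_W` and every `ϖ` with
`ϖ·Ω_W = Ω_f⁺` there is `g ∈ Λ` with `ι g = ϖ·L₂(f, α)` and **`g ~ (T+2)^{rank W₂(ℚ)}`, `μ(g) = 0`, `λ(g) = rank W₂(ℚ)`, `HasOrderAtNegTwo g (rank W₂(ℚ))`** —
the `2`-adic `L`-function vanishes at the twist character `T = −2` to order exactly the rank of the twist (p812157's `char X = ((T+2)^{rank})` read through MC₂).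
[cite: MazurTateTeitelbaum1986Invent, §I.14] [cite: Kato2004Asterisque, Thm. 17.4 (1)(2) (p. 273)] [cite: GreenbergLNM1716, Thm. 4.1 (p. 102), §4 p. 107] -/
theorem padicLFunction_associated_of_bsdp_of_lValue_of_le_mordellWeilRank_twist
    (h17 : ∀ [NeZero (W.conductorNorm ℤ)] (f : CuspForm (Gamma0 (W.conductorNorm ℤ)) 2),
      kato_divisibility_allPrimes W 2 (f := f))
    (hper : realPeriodRat_eq_unit_mul_plusPeriod_two) (hmod : nonempty_modularParametrizationData)
    (hGZK : rank_eq_analyticRank_of_analyticRank_le_one) (hord : IsOrdinaryAt W 2)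
    (ht : ∀ x : ℚ, ¬ HasRationalTwoTorsionX W x) (hr : W.analyticRank = 0) (hbsd : BSDp W 2)
    (htam : Odd W.tamagawaProduct)
    (hL : ∃ q : ℚ, q ≠ 0 ∧ W.entireLFunction 1 / (W.realPeriodRat : ℂ) = (q : ℂ) ∧ padicValRat 2 q = 0)
    (hsat : 2 * padicValNat 2 (W.reductionPointCount 2) ≤ W₂.mordellWeilRank)
    (κ : ZpExtension ℚ 2) {γ : Field.absoluteGaloisGroup ℚ} (hκ : κ.IsCyclotomic) (hγ : κ.IsTopGenerator γ)
    (hγ' : IsCyclotomicVariable 2 γ) [NeZero (W.conductorNorm ℤ)] (f : CuspForm (Gamma0 (W.conductorNorm ℤ)) 2) (hf : IsNewformOf W f)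
    (ϖ : ℚ) (hϖ : (ϖ : ℝ) * W.realPeriodRat = plusPeriod f) :
    ∃ g : IwasawaAlgebra 2, iwasawaToPowerSeries 2 g = C (ϖ : ℚ_[2]) * padicLFunction f (unitRoot W 2 : ℚ_[2]) ∧
      Associated ((X + C (2 : ℤ_[2])) ^ W₂.mordellWeilRank) g ∧ mu g = 0 ∧ lam g = W₂.mordellWeilRank ∧
      HasOrderAtNegTwo g W₂.mordellWeilRank := by
  have hMC : MazurMainConjecture W 2 :=
    mazurMainConjecture_two_of_bsdp_of_lValue_of_le_mordellWeilRank_twist W W₂ hV h17 hper hmod hGZK hord ht hr hbsd htam hL hsat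
  let D : W.SelmerDualData κ γ := W.selmerDualData κ hγ
  obtain ⟨-, g, hchar, hg⟩ := hMC κ γ hκ hγ hγ' f hf ϖ hϖ D
  obtain ⟨-, -, hchar'⟩ := forall_mu_eq_zero_of_bsdp_of_lValue_of_le_mordellWeilRank_twist W W₂ hV hGZK hord ht hr hbsd htam hL hsat κ γ hκ hγ hγ' D
  have heq : Ideal.span ({(X + C (2 : ℤ_[2])) ^ W₂.mordellWeilRank} : Set (IwasawaAlgebra 2)) = Ideal.span {g} := by
    rw [← hchar', ← hchar]
  have hass : Associated ((X + C (2 : ℤ_[2])) ^ W₂.mordellWeilRank) g := associated_of_span_singleton_eq heq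
  obtain ⟨hmu0, hlam0⟩ := lam_mu_of_associated_X_add_C_two_pow hass
  exact ⟨g, hg, hass, hmu0, hlam0, hasOrderAtNegTwo_of_associated_X_add_C_two_pow hass⟩

end Cell

end Summit.BirchSwinnertonDyer.BirchSwinnertonDyer.Theorems.AlignedTransportAtTwoTwistSaturation

end
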